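import Literature.Computability.AlgebraicComplexity.ValiantReductionCells
import Literature.Computability.AlgebraicComplexity.Valiant3CNFFlat
import HarnessLib

/-!
# Valiant's reduction as a polynomial-time machine, II: the entries of the original block (`ent0`, `colR`, `V`)

Second machine file (see `ValiantReductionCells.lean` for the setting). The closed form
`Valiant3CNF.mz` of Valiant's integer matrix reads the formula through `ent0 ψ r s` (the clause
blocks: subdiagonal, literal edges `s = 1 - p`, `p`), `colR ψ r o` (the column of an occurrence after
the substitution `Y := 1`) and the fixed `4 × 4` block `V` (`vtab`). Here they become `FP` bricks on
unary arguments, with values in `{-1, 0, 1, 2, 3}` coded as the CLASS `1^{v+1}` (`cls v`):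

* a branching layer with unconditional value lemmas: `iteB c f g` (= `iteFn (headBitFn ∘ c) f g`,
  so that `iteB c f g z = if (c z).headD false then f z else g z` on EVERY input), `andB`, `orB`, `notB`;
* `ValiantFP.vtabF ⟨1ᵃ, 1ᵇ⟩ = cls (vtab a b)` (`vtabF_apply`);
* `ValiantFP.colRF ⟨⌜ψ⌝, ⟨1ʳ, 1ᵒ⟩⟩ = [colR ψ r o = 1]` (`colRF_encode`, `o < 3m`);
* `ValiantFP.ent0F ⟨⌜ψ⌝, ⟨1ʳ, 1ˢ⟩⟩ = cls (ent0 ψ r s)` (`ent0F_encode`, `s < 7m`), through the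
  arithmetic mirror `ent0M` of `ent0` (`ent0M_eq_ent0`: `7 (s/7) = s - s mod 7`, the literal of
  the block row is occurrence `3 (s/7) + (s mod 7)/2`).

## References

* L. G. Valiant, *The complexity of computing the permanent*, Theoret. Comput. Sci. 8 (1979)
  189–201, Lemma 3.1, Thm. 1.
* S. Arora, B. Barak, *Computational Complexity: A Modern Approach*, CUP 2009, §1.3.
-/

noncomputable section

namespace Literature.Computability.AlgebraicComplexity

open _root_.Computability Literature.Computability.Complexity Brick HashBricks Plumb OracleCompose Polynomial
open Valiant3CNF

namespace ValiantFP

variable (ψ : CNF ℕ)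

/-! ### Unary strings -/

/-- `ones` is injective. [folklore] -/
@[simp] theorem ones_inj {a b : ℕ} : ones a = ones b ↔ a = b :=
  ⟨fun h => by simpa using congrArg List.length h, fun h => by rw [h]⟩

/-- `1ᵃ ++ 1ᵇ = 1^{a+b}`. [folklore] -/
@[simp] theorem ones_append (a b : ℕ) : ones a ++ ones b = ones (a + b) := by
  simp [ones]

/-- `true :: 1ᵃ = 1^{a+1}`. [folklore] -/
theorem true_cons_ones (a : ℕ) : true :: ones a = ones (a + 1) := rfl

/-- `drop b 1ᵃ = 1^{a-b}`. [folklore] -/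
@[simp] theorem ones_drop (a b : ℕ) : (ones a).drop b = ones (a - b) := by
  simp [ones]

/-- `1ᵃ = ε ↔ a = 0`. [folklore] -/
@[simp] theorem ones_eq_nil {a : ℕ} : ones a = [] ↔ a = 0 := by
  simp [ones]

/-- `ε = 1ᵃ ↔ a = 0`. [folklore] -/
@[simp] theorem nil_eq_ones {a : ℕ} : [] = ones a ↔ a = 0 :=
  ⟨fun h => ones_eq_nil.1 h.symm, fun h => (ones_eq_nil.2 h).symm⟩

/-- `(1ᵃ).headD false = (0 < a)`. [folklore] -/
@[simp] theorem headD_ones (a : ℕ) : (ones a).headD false = decide (0 < a) := by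
  cases a with
  | zero => rfl
  | succ n => rw [show ones (n + 1) = true :: ones n from rfl, List.headD_cons]; simp

/-- `|1ᵃ| = a`. [folklore] -/
@[simp] theorem length_ones (a : ℕ) : (ones a).length = a := List.length_replicate ..

/-- The class of a small integer: `cls v = 1^{v+1}` (`-1 ↦ ε`, `0 ↦ 1`, …, `3 ↦ 1111`). [folklore] -/
def cls (v : ℤ) : List Bool := ones (v + 1).toNat

/-- `cls (-1) = ε`. [folklore] -/
@[simp] theorem cls_neg_one : cls (-1) = [] := rfl
/-- `cls 0 = 1`. [folklore] -/
@[simp] theorem cls_zero : cls 0 = [true] := rfl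
/-- `cls 1 = 11`. [folklore] -/
@[simp] theorem cls_one : cls 1 = [true, true] := rfl
/-- `cls 2 = 111`. [folklore] -/
@[simp] theorem cls_two : cls 2 = [true, true, true] := rfl
/-- `cls 3 = 1111`. [folklore] -/
@[simp] theorem cls_three : cls 3 = [true, true, true, true] := rfl

/-- `cls` of an `if`. [folklore] -/
theorem cls_ite (P : Prop) [Decidable P] (a b : ℤ) : cls (if P then a else b) = if P then cls a else cls b := by
  split_ifs <;> rfl

/-! ### Branching with unconditional value lemmas -/

/-- `iteFn` guarded by `headBitFn`, an if-then-else on EVERY input. [cite: AroraBarak2009, §1.3] -/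
def iteB (c f g : List Bool → List Bool) : List Bool → List Bool := iteFn (headBitFn ∘ c) f g

/-- **Value of `iteB`.** [folklore] -/
@[simp] theorem iteB_apply (c f g : List Bool → List Bool) (z : List Bool) :
    iteB c f g z = if (c z).headD false = true then f z else g z := by
  rw [iteB, iteFn_apply (b := (c z).headD false) (by rw [Function.comp_apply, headBitFn_apply])]

/-- `iteB c f g ∈ FP`. [folklore] -/
theorem iteB_mem_FP {c f g : List Bool → List Bool} (hc : c ∈ FP) (hf : f ∈ FP) (hg : g ∈ FP) : iteB c f g ∈ FP :=
  iteFn_mem_FP (comp_mem_FP headBitFn_mem_FP hc) hf hg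

/-- Conjunction of head bits. [folklore] -/
def andB (c d : List Bool → List Bool) : List Bool → List Bool := iteB c (headBitFn ∘ d) (fun _ => [false])

/-- Disjunction of head bits. [folklore] -/
def orB (c d : List Bool → List Bool) : List Bool → List Bool := iteB c (fun _ => [true]) (headBitFn ∘ d)

/-- Negation of the head bit. [folklore] -/
def notB (c : List Bool → List Bool) : List Bool → List Bool := iteB c (fun _ => [false]) (fun _ => [true])

/-- Value of `andB`. [folklore] -/
@[simp] theorem andB_apply (c d : List Bool → List Bool) (z : List Bool) :
    andB c d z = [(c z).headD false && (d z).headD false] := by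
  rw [andB, iteB_apply]
  cases (c z).headD false <;> simp [headBitFn_apply]

/-- Value of `orB`. [folklore] -/
@[simp] theorem orB_apply (c d : List Bool → List Bool) (z : List Bool) :
    orB c d z = [(c z).headD false || (d z).headD false] := by
  rw [orB, iteB_apply]
  cases (c z).headD false <;> simp [headBitFn_apply]

/-- Value of `notB`. [folklore] -/
@[simp] theorem notB_apply (c : List Bool → List Bool) (z : List Bool) : notB c z = [!(c z).headD false] := by
  rw [notB, iteB_apply]
  cases (c z).headD false <;> simp

/-- `andB c d ∈ FP`. [folklore] -/
theorem andB_mem_FP {c d : List Bool → List Bool} (hc : c ∈ FP) (hd : d ∈ FP) : andB c d ∈ FP :=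
  iteB_mem_FP hc (comp_mem_FP headBitFn_mem_FP hd) (const_mem_FP _)

/-- `orB c d ∈ FP`. [folklore] -/
theorem orB_mem_FP {c d : List Bool → List Bool} (hc : c ∈ FP) (hd : d ∈ FP) : orB c d ∈ FP :=
  iteB_mem_FP hc (const_mem_FP _) (comp_mem_FP headBitFn_mem_FP hd)

/-- `notB c ∈ FP`. [folklore] -/
theorem notB_mem_FP {c : List Bool → List Bool} (hc : c ∈ FP) : notB c ∈ FP :=
  iteB_mem_FP hc (const_mem_FP _) (const_mem_FP _)

/-- Equality test of two fields: `eqB f g z = [f z = g z]`. [folklore] -/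
def eqB (f g : List Bool → List Bool) : List Bool → List Bool := eqPairFn ∘ fanoutFn f g

/-- Value of `eqB`. [folklore] -/
@[simp] theorem eqB_apply (f g : List Bool → List Bool) (z : List Bool) : eqB f g z = [decide (f z = g z)] := by
  simp [eqB, eqPairFn_boolPair]

/-- `eqB f g ∈ FP`. [folklore] -/
theorem eqB_mem_FP {f g : List Bool → List Bool} (hf : f ∈ FP) (hg : g ∈ FP) : eqB f g ∈ FP :=
  comp_mem_FP eqPairFn_mem_FP (fanoutFn_mem_FP hf hg)

/-- Length comparison of two fields: `ltB f g z = [|f z| < |g z|]`. [folklore] -/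
def ltB (f g : List Bool → List Bool) : List Bool → List Bool := ltLenF ∘ fanoutFn f g

/-- Value of `ltB`. [folklore] -/
@[simp] theorem ltB_apply (f g : List Bool → List Bool) (z : List Bool) :
    ltB f g z = [decide ((f z).length < (g z).length)] := by
  simp [ltB]

/-- `ltB f g ∈ FP`. [folklore] -/
theorem ltB_mem_FP {f g : List Bool → List Bool} (hf : f ∈ FP) (hg : g ∈ FP) : ltB f g ∈ FP :=
  comp_mem_FP ltLenF_mem_FP (fanoutFn_mem_FP hf hg)

/-- A constant field. [folklore] -/
def cst (w : List Bool) : List Bool → List Bool := fun _ => w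

/-- Value of a constant field. [folklore] -/
@[simp] theorem cst_apply (w z : List Bool) : cst w z = w := rfl

/-- Constant fields are in `FP`. [folklore] -/
theorem cst_mem_FP (w : List Bool) : cst w ∈ FP := const_mem_FP w

/-- Unary difference of two fields: `subB f g z = drop |g z| (f z)` (`1ᵃ, 1ᵇ ↦ 1^{a-b}`). [folklore] -/
def subB (f g : List Bool → List Bool) : List Bool → List Bool := dropFn ∘ fanoutFn g f

/-- Value of `subB`. [folklore] -/
@[simp] theorem subB_apply (f g : List Bool → List Bool) (z : List Bool) : subB f g z = (f z).drop (g z).length := by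
  simp [subB]

/-- `subB f g ∈ FP`. [folklore] -/
theorem subB_mem_FP {f g : List Bool → List Bool} (hf : f ∈ FP) (hg : g ∈ FP) : subB f g ∈ FP :=
  comp_mem_FP dropFn_mem_FP (fanoutFn_mem_FP hg hf)

/-- Unary sum of two fields: `addB f g z = f z ++ g z`. [folklore] -/
def addB (f g : List Bool → List Bool) : List Bool → List Bool := appF ∘ fanoutFn f g

/-- Value of `addB`. [folklore] -/
@[simp] theorem addB_apply (f g : List Bool → List Bool) (z : List Bool) : addB f g z = f z ++ g z := by
  simp [addB, appF]

/-- `addB f g ∈ FP`. [folklore] -/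
theorem addB_mem_FP {f g : List Bool → List Bool} (hf : f ∈ FP) (hg : g ∈ FP) : addB f g ∈ FP :=
  comp_mem_FP appF_mem_FP (fanoutFn_mem_FP hf hg)

/-- Quotient field of a unary division by a constant: `quoB K f z = 1^{|f z| / K}` on unary `f z`. [folklore] -/
def quoB (K : ℕ) (f : List Bool → List Bool) : List Bool → List Bool := fstF ∘ divModFn ∘ fanoutFn (cst (ones K)) f

/-- Remainder field: `remB K f z = 1^{|f z| mod K}` on unary `f z`. [folklore] -/
def remB (K : ℕ) (f : List Bool → List Bool) : List Bool → List Bool := sndF ∘ divModFn ∘ fanoutFn (cst (ones K)) f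

/-- Value of `quoB` on a unary field. [folklore] -/
theorem quoB_apply (K : ℕ) (f : List Bool → List Bool) (z : List Bool) (a : ℕ) (h : f z = ones a) :
    quoB K f z = ones (a / K) := by
  simp [quoB, cst, h]

/-- Value of `remB` on a unary field. [folklore] -/
theorem remB_apply (K : ℕ) (f : List Bool → List Bool) (z : List Bool) (a : ℕ) (h : f z = ones a) :
    remB K f z = ones (a % K) := by
  simp [remB, cst, h]

/-- `quoB K f ∈ FP`. [folklore] -/
theorem quoB_mem_FP (K : ℕ) {f : List Bool → List Bool} (hf : f ∈ FP) : quoB K f ∈ FP :=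
  comp_mem_FP fstF_mem_FP (comp_mem_FP divModFn_mem_FP (fanoutFn_mem_FP (cst_mem_FP _) hf))

/-- `remB K f ∈ FP`. [folklore] -/
theorem remB_mem_FP (K : ℕ) {f : List Bool → List Bool} (hf : f ∈ FP) : remB K f ∈ FP :=
  comp_mem_FP sndF_mem_FP (comp_mem_FP divModFn_mem_FP (fanoutFn_mem_FP (cst_mem_FP _) hf))

/-- A constant multiple of a unary field: `mulB k f z = 1^{k |f z|}`. [folklore] -/
def mulB (k : ℕ) (f : List Bool → List Bool) : List Bool → List Bool := polyFn ((k : Polynomial ℕ) * X) ∘ f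

/-- Value of `mulB`. [folklore] -/
@[simp] theorem mulB_apply (k : ℕ) (f : List Bool → List Bool) (z : List Bool) : mulB k f z = ones (k * (f z).length) := by
  simp [mulB]

/-- `mulB k f ∈ FP`. [folklore] -/
theorem mulB_mem_FP (k : ℕ) {f : List Bool → List Bool} (hf : f ∈ FP) : mulB k f ∈ FP :=
  comp_mem_FP (polyFn_mem_FP _) hf

/-! ### The block `V` -/

/-- One row of the class table of `V`, selected by `1ᵇ = g z`. [cite: BurgisserClausenShokrollahi1997, Thm. (21.29)] -/
def vrowF (g : List Bool → List Bool) (c0 c1 c2 c3 : List Bool) : List Bool → List Bool :=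
  iteB (eqB g (cst (ones 0))) (cst c0) (iteB (eqB g (cst (ones 1))) (cst c1)
    (iteB (eqB g (cst (ones 2))) (cst c2) (iteB (eqB g (cst (ones 3))) (cst c3) (cst (cls 0)))))

/-- `vrowF g … ∈ FP`. [folklore] -/
theorem vrowF_mem_FP {g : List Bool → List Bool} (hg : g ∈ FP) (c0 c1 c2 c3 : List Bool) : vrowF g c0 c1 c2 c3 ∈ FP :=
  iteB_mem_FP (eqB_mem_FP hg (cst_mem_FP _)) (cst_mem_FP _) (iteB_mem_FP (eqB_mem_FP hg (cst_mem_FP _)) (cst_mem_FP _)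
    (iteB_mem_FP (eqB_mem_FP hg (cst_mem_FP _)) (cst_mem_FP _) (iteB_mem_FP (eqB_mem_FP hg (cst_mem_FP _)) (cst_mem_FP _) (cst_mem_FP _))))

/-- **The class of `V a b`** on fields `f z = 1ᵃ`, `g z = 1ᵇ`. [cite: BurgisserClausenShokrollahi1997, Thm. (21.29)] -/
def vtabF (f g : List Bool → List Bool) : List Bool → List Bool :=
  iteB (eqB f (cst (ones 0))) (vrowF g (cls 0) (cls 1) (cls (-1)) (cls (-1)))
    (iteB (eqB f (cst (ones 1))) (vrowF g (cls 1) (cls (-1)) (cls 1) (cls 1))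
      (iteB (eqB f (cst (ones 2))) (vrowF g (cls 0) (cls 1) (cls 1) (cls 2))
        (iteB (eqB f (cst (ones 3))) (vrowF g (cls 0) (cls 1) (cls 3) (cls 0)) (cst (cls 0)))))

/-- `vtabF f g ∈ FP`. [folklore] -/
theorem vtabF_mem_FP {f g : List Bool → List Bool} (hf : f ∈ FP) (hg : g ∈ FP) : vtabF f g ∈ FP :=
  iteB_mem_FP (eqB_mem_FP hf (cst_mem_FP _)) (vrowF_mem_FP hg _ _ _ _) (iteB_mem_FP (eqB_mem_FP hf (cst_mem_FP _)) (vrowF_mem_FP hg _ _ _ _)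
    (iteB_mem_FP (eqB_mem_FP hf (cst_mem_FP _)) (vrowF_mem_FP hg _ _ _ _)
      (iteB_mem_FP (eqB_mem_FP hf (cst_mem_FP _)) (vrowF_mem_FP hg _ _ _ _) (cst_mem_FP _))))

/-- **Value of `vtabF`**: the class of `vtab a b`. [cite: BurgisserClausenShokrollahi1997, Thm. (21.29)] -/
theorem vtabF_apply (f g : List Bool → List Bool) (z : List Bool) (a b : ℕ) (hf : f z = ones a) (hg : g z = ones b) :
    vtabF f g z = cls (vtab a b) := by
  simp only [vtabF, vrowF, iteB_apply, eqB_apply, cst_apply, hf, hg, ones_inj, List.headD_cons, decide_eq_true_eq, vtab]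
  split_ifs <;> first | rfl | (exfalso; omega)

/-! ### The column of an occurrence: `colR` -/

/-- `1^{dpos o}` from a field `g z = 1ᵒ`: `7 (o/3) + 2 (o mod 3) + 1`. [cite: Valiant1979, Lemma 3.1] -/
def dposB (g : List Bool → List Bool) : List Bool → List Bool :=
  addB (mulB 7 (quoB 3 g)) (addB (mulB 2 (remB 3 g)) (cst [true]))

/-- Value of `dposB`. [folklore] -/
theorem dposB_apply (g : List Bool → List Bool) (z : List Bool) (o : ℕ) (hg : g z = ones o) :
    dposB g z = ones (dpos o) := by
  simp only [dposB, addB_apply, mulB_apply, cst_apply, quoB_apply 3 g z o hg, remB_apply 3 g z o hg, length_ones, dpos,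
    show [true] = ones 1 from rfl, ones_append]
  exact congrArg ones (by omega)

/-- `dposB g ∈ FP`. [folklore] -/
theorem dposB_mem_FP {g : List Bool → List Bool} (hg : g ∈ FP) : dposB g ∈ FP :=
  addB_mem_FP (mulB_mem_FP 7 (quoB_mem_FP 3 hg)) (addB_mem_FP (mulB_mem_FP 2 (remB_mem_FP 3 hg)) (cst_mem_FP _))

/-- **`colRF ⟨⌜ψ⌝, ⟨1ʳ, 1ᵒ⟩⟩ = [colR ψ r o = 1]`**: `r = dpos o + 1`, or `r = dpos o`, or
`r + 1 = dpos o` and the literal of `o` is positive. [cite: Valiant1979, Lemma 3.1] -/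
def colRF : List Bool → List Bool :=
  orB (eqB (fstF ∘ sndF) (List.cons true ∘ dposB (sndF ∘ sndF)))
    (orB (eqB (fstF ∘ sndF) (dposB (sndF ∘ sndF)))
      (andB (eqB (List.cons true ∘ fstF ∘ sndF) (dposB (sndF ∘ sndF))) (polF ∘ fanoutFn fstF (sndF ∘ sndF))))

/-- `colRF ∈ FP`. [folklore] -/
theorem colRF_mem_FP : colRF ∈ FP :=
  orB_mem_FP (eqB_mem_FP (comp_mem_FP fstF_mem_FP sndF_mem_FP) (comp_mem_FP (cons_mem_FP true) (dposB_mem_FP (comp_mem_FP sndF_mem_FP sndF_mem_FP))))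
    (orB_mem_FP (eqB_mem_FP (comp_mem_FP fstF_mem_FP sndF_mem_FP) (dposB_mem_FP (comp_mem_FP sndF_mem_FP sndF_mem_FP)))
      (andB_mem_FP (eqB_mem_FP (comp_mem_FP (cons_mem_FP true) (comp_mem_FP fstF_mem_FP sndF_mem_FP)) (dposB_mem_FP (comp_mem_FP sndF_mem_FP sndF_mem_FP)))
        (comp_mem_FP polF_mem_FP (fanoutFn_mem_FP fstF_mem_FP (comp_mem_FP sndF_mem_FP sndF_mem_FP)))))

/-- `colR` through `lit3`, in range. [cite: Valiant1979, Lemma 3.1] -/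
theorem colR_eq (hw : CNF.IsWidthEq 3 ψ) (r : ℕ) (o : Fin (3 * ψ.length)) :
    colR ψ r o.val = if r = dpos o.val + 1 then 1 else if r = dpos o.val then 1
      else if r + 1 = dpos o.val then (if (lit3 ψ hw o).2 then 1 else 0) else 0 := by
  rw [colR, lit?_eq ψ hw o]
  rfl

/-- **Value of `colRF`.** [cite: Valiant1979, Lemma 3.1] -/
theorem colRF_encode (hw : CNF.IsWidthEq 3 ψ) (r : ℕ) (o : Fin (3 * ψ.length)) :
    colRF (boolPair (encodingCNF.encode ψ) (boolPair (ones r) (ones o.val))) = [decide (colR ψ r o.val = 1)] := by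
  have hd : dposB (sndF ∘ sndF) (boolPair (encodingCNF.encode ψ) (boolPair (ones r) (ones o.val))) = ones (dpos o.val) :=
    dposB_apply _ _ o.val (by simp)
  simp only [colRF, orB_apply, andB_apply, eqB_apply, Function.comp_apply, fanoutFn_apply, fstF_boolPair, sndF_boolPair,
    hd, polF_encode ψ hw o, true_cons_ones, ones_inj, List.headD_cons, colR_eq ψ hw r o]
  rcases Bool.eq_false_or_eq_true (lit3 ψ hw o).2 with hb | hb <;>
    by_cases h1 : r = dpos o.val + 1 <;> by_cases h2 : r = dpos o.val <;> by_cases h3 : r + 1 = dpos o.val <;>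
      simp [hb, h1, h2, h3]

/-! ### The clause blocks: `ent0` -/

/-- **Arithmetic mirror of `ent0 ψ r s`** (`s < 7m`), the polarity of the literal of the block
row being `b`: with `t = s mod 7` (so `7 (s/7) = s - t`) and `a = r - (s - t)`:
subdiagonal `r = s + 1 ↦ 1`; below / left of the block `↦ 0`; last column (`t = 6`):
`[a = 0] - [a = 6]`; literal node `a = t` even `↦ 1 - p - p = ∓1` (`litSZ`); `a + 1 = t` odd `↦ p`
(`litPZ`); else `0`. [cite: Valiant1979, Lemma 3.1] -/
def ent0M (r s : ℕ) (b : Bool) : ℤ :=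
  if r = s + 1 then 1 else if s < r then 0 else if r < s - s % 7 then 0
  else if s % 7 = 6 then (if r - (s - s % 7) = 0 then 1 else if r - (s - s % 7) = 6 then -1 else 0)
  else if s % 7 % 2 = 0 ∧ r - (s - s % 7) = s % 7 then (if b then -1 else 1)
  else if ¬ s % 7 % 2 = 0 ∧ r - (s - s % 7) + 1 = s % 7 then (if b then 1 else 0)
  else 0

/-- **`ent0 = ent0M`** in range, `b` the polarity of occurrence `3 (s/7) + (s mod 7)/2` whenever
`s mod 7 ≠ 6`. [cite: Valiant1979, Lemma 3.1] -/
theorem ent0_eq_ent0M (hw : CNF.IsWidthEq 3 ψ) (r s : ℕ) (hs : s < 7 * ψ.length) (b : Bool)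
    (hb : ∀ h6 : s % 7 ≠ 6, b = (lit3 ψ hw ⟨3 * (s / 7) + s % 7 / 2, by omega⟩).2) :
    ent0 ψ r s = ent0M r s b := by
  have hj : s / 7 < ψ.length := by omega
  have h7 : 7 * (s / 7) = s - s % 7 := by omega
  unfold ent0 ent0M
  by_cases h1 : r = s + 1
  · rw [if_pos h1, if_pos h1]
  rw [if_neg h1, if_neg h1]
  by_cases h2 : s < r
  · rw [if_pos h2, if_pos h2]
  rw [if_neg h2, if_neg h2, h7]
  by_cases h3 : r < s - s % 7
  · rw [if_pos h3, if_pos h3]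
  rw [if_neg h3, if_neg h3, List.getD_eq_getElem?_getD, List.getElem?_eq_getElem hj, Option.getD_some,
    show s + 1 - (s - s % 7) = s % 7 + 1 by omega]
  unfold locZ
  by_cases h6 : s % 7 = 6
  · rw [if_pos (by omega), if_pos h6]
    by_cases ha : r - (s - s % 7) = 0
    · have ha' : ¬ r - (s - s % 7) = 6 := by omega
      rw [if_pos ha, if_neg ha', if_pos ha]; rfl
    · rw [if_neg ha, if_neg ha]
      by_cases ha' : r - (s - s % 7) = 6
      · rw [if_pos ha']; rfl
      · rw [if_neg ha']; rfl
  rw [if_neg (by omega), if_neg h6, show (s % 7 + 1 - 1) / 2 = s % 7 / 2 by omega]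
  have hi : s % 7 / 2 < (ψ[s / 7]).length := by rw [hw _ (List.getElem_mem _)]; omega
  rw [List.getElem?_eq_getElem hi]
  have ho : 3 * (s / 7) + s % 7 / 2 < 3 * ψ.length := by omega
  have hl : (ψ[s / 7])[s % 7 / 2] = lit3 ψ hw ⟨3 * (s / 7) + s % 7 / 2, ho⟩ := by
    have e1 : (3 * (s / 7) + s % 7 / 2) / 3 = s / 7 := by omega
    have e2 : (3 * (s / 7) + s % 7 / 2) % 3 = s % 7 / 2 := by omega
    have h' : lit? ψ (3 * (s / 7) + s % 7 / 2) = some ((ψ[s / 7])[s % 7 / 2]) := by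
      rw [lit?, e1, e2, List.getElem?_eq_getElem hj, Option.bind_some, List.getElem?_eq_getElem hi]
    exact Option.some_inj.1 (h'.symm.trans (lit?_eq ψ hw ⟨_, ho⟩))
  rw [hb h6]
  simp only [hl]
  by_cases h4 : s % 7 % 2 = 0 ∧ r - (s - s % 7) = s % 7
  · rw [if_pos (by omega), if_pos h4]; unfold litSZ; rfl
  rw [if_neg (by omega), if_neg h4]
  by_cases h5 : ¬ s % 7 % 2 = 0 ∧ r - (s - s % 7) + 1 = s % 7
  · rw [if_pos (by omega), if_pos h5]; unfold litPZ; rfl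
  rw [if_neg (by omega), if_neg h5]

section Ent0Brick

/-- The row field `1ʳ` of `⟨x₀, ⟨1ʳ, 1ˢ⟩⟩`. [folklore] -/
def fR : List Bool → List Bool := fstF ∘ sndF
/-- The column field `1ˢ` of `⟨x₀, ⟨1ʳ, 1ˢ⟩⟩`. [folklore] -/
def fS : List Bool → List Bool := sndF ∘ sndF
/-- `1^{s mod 7}`. [folklore] -/
def fS7 : List Bool → List Bool := remB 7 fS
/-- `1^{s - s mod 7}` (`= 1^{7 (s/7)}`). [folklore] -/
def fSm : List Bool → List Bool := subB fS fS7
/-- `1^{r - (s - s mod 7)}`. [folklore] -/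
def fA : List Bool → List Bool := subB fR fSm
/-- `1^{(s mod 7) mod 2}`. [folklore] -/
def fP2 : List Bool → List Bool := remB 2 fS7
/-- `1^{3 (s/7) + (s mod 7)/2}`: the occurrence of the literal of the block row. [folklore] -/
def fOcc : List Bool → List Bool := addB (mulB 3 (quoB 7 fS)) (quoB 2 fS7)
/-- The polarity bit of that occurrence. [folklore] -/
def fPol : List Bool → List Bool := polF ∘ fanoutFn fstF fOcc

/-- **The class of `ent0 ψ r s`** on `⟨⌜ψ⌝, ⟨1ʳ, 1ˢ⟩⟩`, following `ent0M`. [cite: Valiant1979, Lemma 3.1] -/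
def ent0F : List Bool → List Bool :=
  iteB (eqB fR (List.cons true ∘ fS)) (cst (cls 1))
    (iteB (ltB fS fR) (cst (cls 0))
      (iteB (ltB fR fSm) (cst (cls 0))
        (iteB (eqB fS7 (cst (ones 6)))
          (iteB (eqB fA (cst [])) (cst (cls 1)) (iteB (eqB fA (cst (ones 6))) (cst (cls (-1))) (cst (cls 0))))
          (iteB (andB (eqB fP2 (cst [])) (eqB fA fS7))
            (iteB fPol (cst (cls (-1))) (cst (cls 1)))
            (iteB (andB (notB (eqB fP2 (cst []))) (eqB (List.cons true ∘ fA) fS7))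
              (iteB fPol (cst (cls 1)) (cst (cls 0)))
              (cst (cls 0)))))))

/-- `ent0F ∈ FP`. [folklore] -/
theorem ent0F_mem_FP : ent0F ∈ FP := by
  have hR : fR ∈ FP := by unfold fR; exact comp_mem_FP fstF_mem_FP sndF_mem_FP
  have hS : fS ∈ FP := by unfold fS; exact comp_mem_FP sndF_mem_FP sndF_mem_FP
  have hS7 : fS7 ∈ FP := by unfold fS7; exact remB_mem_FP 7 hS
  have hSm : fSm ∈ FP := by unfold fSm; exact subB_mem_FP hS hS7
  have hA : fA ∈ FP := by unfold fA; exact subB_mem_FP hR hSm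
  have hP2 : fP2 ∈ FP := by unfold fP2; exact remB_mem_FP 2 hS7
  have hOcc : fOcc ∈ FP := by unfold fOcc; exact addB_mem_FP (mulB_mem_FP 3 (quoB_mem_FP 7 hS)) (quoB_mem_FP 2 hS7)
  have hPol : fPol ∈ FP := by unfold fPol; exact comp_mem_FP polF_mem_FP (fanoutFn_mem_FP fstF_mem_FP hOcc)
  have hc : ∀ w : List Bool, (cst w) ∈ FP := fun w => cst_mem_FP w
  exact iteB_mem_FP (eqB_mem_FP hR (comp_mem_FP (cons_mem_FP true) hS)) (hc _)
    (iteB_mem_FP (ltB_mem_FP hS hR) (hc _)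
      (iteB_mem_FP (ltB_mem_FP hR hSm) (hc _)
        (iteB_mem_FP (eqB_mem_FP hS7 (hc _))
          (iteB_mem_FP (eqB_mem_FP hA (hc _)) (hc _) (iteB_mem_FP (eqB_mem_FP hA (hc _)) (hc _) (hc _)))
          (iteB_mem_FP (andB_mem_FP (eqB_mem_FP hP2 (hc _)) (eqB_mem_FP hA hS7))
            (iteB_mem_FP hPol (hc _) (hc _))
            (iteB_mem_FP (andB_mem_FP (notB_mem_FP (eqB_mem_FP hP2 (hc _))) (eqB_mem_FP (comp_mem_FP (cons_mem_FP true) hA) hS7))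
              (iteB_mem_FP hPol (hc _) (hc _)) (hc _))))))

/-- **Value of `ent0F`** on `⟨x₀, ⟨1ʳ, 1ˢ⟩⟩`: the class of `ent0M r s b`, `b` the head bit of the
polarity field. [cite: Valiant1979, Lemma 3.1] -/
theorem ent0F_apply (x₀ : List Bool) (r s : ℕ) :
    ent0F (boolPair x₀ (boolPair (ones r) (ones s))) =
      cls (ent0M r s ((polF (boolPair x₀ (ones (3 * (s / 7) + s % 7 / 2)))).headD false)) := by
  have hR : fR (boolPair x₀ (boolPair (ones r) (ones s))) = ones r := by simp [fR]
  have hS : fS (boolPair x₀ (boolPair (ones r) (ones s))) = ones s := by simp [fS]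
  have hS7 : fS7 (boolPair x₀ (boolPair (ones r) (ones s))) = ones (s % 7) := by unfold fS7; exact remB_apply 7 _ _ s hS
  have hSm : fSm (boolPair x₀ (boolPair (ones r) (ones s))) = ones (s - s % 7) := by
    unfold fSm
    rw [subB_apply, hS, hS7, length_ones, ones_drop]
  have hA : fA (boolPair x₀ (boolPair (ones r) (ones s))) = ones (r - (s - s % 7)) := by
    unfold fA
    rw [subB_apply, hSm, hR, length_ones, ones_drop]
  have hP2 : fP2 (boolPair x₀ (boolPair (ones r) (ones s))) = ones (s % 7 % 2) := by unfold fP2; exact remB_apply 2 _ _ _ hS7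
  have hOcc : fOcc (boolPair x₀ (boolPair (ones r) (ones s))) = ones (3 * (s / 7) + s % 7 / 2) := by
    unfold fOcc
    rw [addB_apply, mulB_apply, quoB_apply 7 _ _ s hS, quoB_apply 2 _ _ _ hS7, length_ones, ones_append]
  have hPol : fPol (boolPair x₀ (boolPair (ones r) (ones s))) = polF (boolPair x₀ (ones (3 * (s / 7) + s % 7 / 2))) := by
    unfold fPol
    rw [Function.comp_apply, fanoutFn_apply, fstF_boolPair, hOcc]
  simp only [ent0F, iteB_apply, eqB_apply, ltB_apply, andB_apply, notB_apply, Function.comp_apply, hR, hS, hS7, hSm, hA,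
    hP2, hPol, true_cons_ones, List.headD_cons, length_ones, ones_inj, ones_eq_nil, ent0M, cls_ite, cst_apply,
    decide_eq_true_eq, Bool.and_eq_true, Bool.not_eq_true', decide_eq_false_iff_not]

/-- **`ent0F` computes the class of `ent0`** on the code of a 3-CNF, for `s < 7m`. [cite: Valiant1979, Lemma 3.1] -/
theorem ent0F_encode (hw : CNF.IsWidthEq 3 ψ) (r s : ℕ) (hs : s < 7 * ψ.length) :
    ent0F (boolPair (encodingCNF.encode ψ) (boolPair (ones r) (ones s))) = cls (ent0 ψ r s) := by
  rw [ent0F_apply, ent0_eq_ent0M ψ hw r s hs]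
  intro h6
  have ho : 3 * (s / 7) + s % 7 / 2 < 3 * ψ.length := by omega
  have := polF_encode ψ hw ⟨_, ho⟩
  rw [this]
  rfl

end Ent0Brick

end ValiantFP

end Literature.Computability.AlgebraicComplexity
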